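import Literature.NumberTheory.Automorphic.UnitaryGroupAdelicProduct
import Literature.NumberTheory.Automorphic.UnitaryGroupOfFormAdelicTopology
import Literature.NumberTheory.Automorphic.AdeleRingTopology
import Mathlib.MeasureTheory.Group.Measure
import HarnessLib

/-!
# `U(J)(F)` is discrete in `U(J)(𝔸_F)`; the level subgroups `U(J)(E ⊗ ℝ) × K_f` when `U(J)(E ⊗ ℝ)` is compact

Topic `NumberTheory/Automorphic`; namespace `Literature.NumberTheory.Automorphic.UnitaryGroup`.  KERNEL only: theorems proved from
the tree's unitary-group adelic API (`UnitaryGroupAutomorphicRep`, `UnitaryGroupAdelicProduct`, `AdeleRingTopology`) and Mathlib; no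
definition of record, no named fact, no `sorry`.  For the tree's unitary group `U(J)` of a matrix `J ∈ M_N(E)` relative to a quadratic
extension `E/F` of number fields with involution `c`:

* §1 `discreteTopology_range_toAdelic` — **`U(J)(F)` is a DISCRETE subgroup of `U(J)(𝔸_F)`** ([Borel1963, §1.2 «They are discrete»]:
  `E ⊂ 𝔸_E` is discrete, the tree's `AdeleRing.discreteTopology_principalSubgroup`, and a rational point is determined continuously by
  its matrix of principal-adele entries — the argument of the tree's CM-only `discreteTopology_adelicUnitaryRat`, here for every `E/F`, `c`,
  `J`); `isClosed_range_toAdelic`; **`finite_range_inter_of_isCompact`** — `U(J)(F)` meets every compact subset of `U(J)(𝔸_F)` in a finite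
  set.
* §2 for a COMPACT archimedean member `U(J)(E ⊗ ℝ)` (e.g. `J` definite at every archimedean place of a CM extension): the finite
  projection `g ↦ g_f` is proper (`isCompact_preimage_finPart`, `tendsto_finPart_cocompact`), so the level sets `{g | g_f ∈ K_f}` of a compact
  open `K_f ≤ U(J)(𝔸_{F,f})` are compact open (`isOpen_preimage_finPart`), meet `U(J)(F)` in finitely many points
  (`finite_range_inter_preimage_finPart`), and the image of a Haar measure of `U(J)(𝔸_F)` under `g ↦ g_f` is a Haar measure of
  `U(J)(𝔸_{F,f})` (`isHaarMeasure_map_finPart`, Mathlib `isHaarMeasure_map`) — [BorelJacquet1979, §4.1] `G(𝔸) = G_∞ × G(𝔸_f)`.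

These are the structural inputs of «lattice sums are dominated by adelic integrals» for the orbital sums
`Σ_{γ ∈ U(J_W)(F)} |⟨ω(h₂⁻¹γh₁)φ₁, φ₂⟩|` of [Li1992, (24)–(25)] (cell `hodgecm-mathlib`, crux H413, E-2 desk, `StubSW2` (ii), Road C).

## References
* [Borel1963] A. Borel, *Some finiteness properties of adele groups over number fields*, Publ. Math. IHÉS 16 (1963), §1.2.
* [BorelJacquet1979] A. Borel, H. Jacquet, *Automorphic forms and automorphic representations*, Proc. Symp. Pure Math. 33.1 (1979), §4.1.
* [Li1992] J.-S. Li, J. reine angew. Math. 428 (1992), (24)–(25) p. 184.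
-/

set_option autoImplicit false

noncomputable section

open NumberField IsDedekindDomain Topology Filter MeasureTheory
open scoped Matrix MatrixGroups

namespace Literature.NumberTheory.Automorphic

namespace UnitaryGroup

open NumberField.mixedEmbedding

variable (F E : Type) [Field F] [Field E] [NumberField E] [Algebra F E]
  (c : E ≃ₐ[F] E) (N : ℕ) (J : Matrix (Fin N) (Fin N) E)

/-! ## §1 `U(J)(F)` is discrete in `U(J)(𝔸_F)` -/

/-- the matrix entries of a rational point, embedded in `U(J)(𝔸_F) ≤ GL_N(𝔸_E)`, are principal adeles. [cite: Borel1963, §1.2] -/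
theorem entry_mem_principalSubgroup (γ : (toAdelic F E c N J).range) (i j : Fin N) :
    (((γ : adelic F E c N J) : GL (Fin N) (AdeleRing (𝓞 E) E)) : Matrix (Fin N) (Fin N) (AdeleRing (𝓞 E) E)) i j ∈
      AdeleRing.principalSubgroup (𝓞 E) E := by
  obtain ⟨_, γ₀, rfl⟩ := γ
  exact ⟨((γ₀ : GL (Fin N) E) : Matrix (Fin N) (Fin N) E) i j, rfl⟩

/-- **`U(J)(F)` is a discrete subgroup of `U(J)(𝔸_F)`** (Borel: the rational points «are discrete» in the adelic points), for every
quadratic `E/F`, involution `c` and matrix `J`: `E` is discrete in `𝔸_E` (the tree's `AdeleRing.discreteTopology_principalSubgroup`) and a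
rational point is determined, continuously and injectively, by its matrix of principal-adele entries. [cite: Borel1963, §1.2] -/
theorem discreteTopology_range_toAdelic : DiscreteTopology (toAdelic F E c N J).range := by
  haveI := AdeleRing.discreteTopology_principalSubgroup E
  -- the entry map into matrices of (discrete) principal adeles
  let f : (toAdelic F E c N J).range → Matrix (Fin N) (Fin N) (AdeleRing.principalSubgroup (𝓞 E) E) :=
    fun γ i j => ⟨_, entry_mem_principalSubgroup F E c N J γ i j⟩
  have hval : Continuous fun γ : (toAdelic F E c N J).range =>
      (((γ : adelic F E c N J) : GL (Fin N) (AdeleRing (𝓞 E) E)) : Matrix (Fin N) (Fin N) (AdeleRing (𝓞 E) E)) :=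
    Units.continuous_val.comp (continuous_subtype_val.comp continuous_subtype_val)
  have hf : Continuous f :=
    continuous_pi fun i => continuous_pi fun j => (hval.matrix_elem i j).subtype_mk _
  have hinj : Function.Injective f := by
    intro γ δ h
    apply Subtype.ext; apply Subtype.ext; apply Units.ext
    ext i j
    exact congrArg Subtype.val (congrFun (congrFun h i) j)
  exact DiscreteTopology.of_continuous_injective hf hinj

/-- `U(J)(F)` is closed in `U(J)(𝔸_F)` (a discrete subgroup of a Hausdorff group). [cite: Borel1963, §1.2] -/
theorem isClosed_range_toAdelic : IsClosed ((toAdelic F E c N J).range : Set (adelic F E c N J)) := by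
  haveI := discreteTopology_range_toAdelic F E c N J
  exact Subgroup.isClosed_of_discrete

/-- **`U(J)(F)` meets every compact subset of `U(J)(𝔸_F)` in a FINITE set** (discrete and closed). [cite: Borel1963, §1.2] -/
theorem finite_range_inter_of_isCompact {K : Set (adelic F E c N J)} (hK : IsCompact K) :
    (((toAdelic F E c N J).range : Set (adelic F E c N J)) ∩ K).Finite := by
  haveI := discreteTopology_range_toAdelic F E c N J
  have hc : IsCompact (((toAdelic F E c N J).range : Set (adelic F E c N J)) ∩ K) :=
    hK.inter_left (isClosed_range_toAdelic F E c N J)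
  exact hc.finite ((isDiscrete_iff_discreteTopology.2 (discreteTopology_range_toAdelic F E c N J)).mono Set.inter_subset_left)

variable [NumberField F]

/-! ## §2 Compact archimedean member: the level subgroups `{g | g_f ∈ K_f}` and the finite projection of Haar measure -/

/-- `{g | g_f ∈ K_f} = (g ↦ (g_∞, g_f))⁻¹(U(J)(E⊗ℝ) × K_f)`. [cite: BorelJacquet1979, §4.1] -/
theorem preimage_finPart_eq (Kf : Set (finAdelic F E c N J)) :
    ((finPart F E c N J) ⁻¹' Kf : Set (adelicGroupData F E c N J).Adelic) =
      (adelicProdEquiv F E c N J) ⁻¹' ((Set.univ : Set (arch F E c N J)) ×ˢ Kf) := by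
  ext g
  simp only [Set.mem_preimage, adelicProdEquiv_apply, Set.mem_prod, Set.mem_univ, true_and]

/-- `{g | g_f ∈ K_f}` is open for `K_f` open. [cite: BorelJacquet1979, §4.1] -/
theorem isOpen_preimage_finPart {Kf : Set (finAdelic F E c N J)} (hKf : IsOpen Kf) :
    IsOpen ((finPart F E c N J) ⁻¹' Kf : Set (adelicGroupData F E c N J).Adelic) :=
  hKf.preimage (continuous_finPart F E c N J)

variable [CompactSpace (arch F E c N J)]

/-- **for `U(J)(E ⊗ ℝ)` compact, `{g | g_f ∈ K_f}` is compact for `K_f` compact** (`≅ U(J)(E⊗ℝ) × K_f`). [cite: BorelJacquet1979, §4.1] -/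
theorem isCompact_preimage_finPart {Kf : Set (finAdelic F E c N J)} (hKf : IsCompact Kf) :
    IsCompact ((finPart F E c N J) ⁻¹' Kf : Set (adelicGroupData F E c N J).Adelic) := by
  rw [preimage_finPart_eq]
  exact ((adelicProdEquiv F E c N J).toHomeomorph.isCompact_preimage).2 (isCompact_univ.prod hKf)

/-- for `U(J)(E ⊗ ℝ)` compact the finite projection `g ↦ g_f` is PROPER. [cite: BorelJacquet1979, §4.1] -/
theorem tendsto_finPart_cocompact :
    Tendsto (finPart F E c N J) (cocompact (adelicGroupData F E c N J).Adelic) (cocompact (finAdelic F E c N J)) := by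
  refine Filter.hasBasis_cocompact.tendsto_right_iff.2 fun K hK => ?_
  exact (isCompact_preimage_finPart F E c N J hK).compl_mem_cocompact

/-- **for `U(J)(E ⊗ ℝ)` compact, `U(J)(F)` has only FINITELY many points `γ` with `γ_f ∈ K_f`**, `K_f` compact (at a totally definite `J` these
are the «units» of the lattice stabilised by `K_f`, a finite group). [cite: Borel1963, §1.2] [cite: BorelJacquet1979, §4.1] -/
theorem finite_range_inter_preimage_finPart {Kf : Set (finAdelic F E c N J)} (hKf : IsCompact Kf) :
    (((toAdelic F E c N J).range : Set (adelic F E c N J)) ∩ (finPart F E c N J) ⁻¹' Kf).Finite :=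
  finite_range_inter_of_isCompact F E c N J (isCompact_preimage_finPart F E c N J hKf)

/-- **for `U(J)(E ⊗ ℝ)` compact, the finite projection of a Haar measure of `U(J)(𝔸_F)` is a Haar measure of `U(J)(𝔸_{F,f})`**
(continuous, surjective — section `b ↦ (1, b)` —, proper). [cite: BorelJacquet1979, §4.1] -/
theorem isHaarMeasure_map_finPart [MeasurableSpace (adelicGroupData F E c N J).Adelic] [BorelSpace (adelicGroupData F E c N J).Adelic]
    [MeasurableSpace (finAdelic F E c N J)] [BorelSpace (finAdelic F E c N J)]
    (μ : Measure (adelicGroupData F E c N J).Adelic) [μ.IsHaarMeasure] :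
    (μ.map (finPart F E c N J)).IsHaarMeasure :=
  μ.isHaarMeasure_map (finPart F E c N J) (continuous_finPart F E c N J) (finPart_surjective F E c N J)
    (tendsto_finPart_cocompact F E c N J)

end UnitaryGroup

end Literature.NumberTheory.Automorphic

end
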